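import Literature.Geometry.Riemannian.CurvatureDerivativeNormSq
import Literature.Geometry.Riemannian.RicciFlowShiEstimates
import Literature.Geometry.Riemannian.CurvatureFamilyRegularity
import Literature.Geometry.Riemannian.CurvatureNormSq
import Summits.SmoothPoincare4.SmoothPoincare4.Theorems.EntropyRungChangGurskyYangStubRoundnessRateAux
import Summits.SmoothPoincare4.SmoothPoincare4.Theorems.EntropyRungChangGurskyYangStubSmoothRoundLimitDecayOneAux
import HarnessLib

/-!
# Decay of `|∇Rm|²` for a roundening Type-I Ricci flow (Hamilton 1982, §17, Thm. 17.6, `k = 1`)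
(helper `helper_curvDeriv_decay_one` = layer S3b of stub `stub_smoothRoundLimit` of line
`margerin-cone-hamilton-rails`, crux `EntropyRung.ChangGurskyYang`, item stmt-SmoothPoincare4-10834)

Along a Ricci flow of Riemannian metrics on `[0, T)`, `T > 0`, on a closed 4-manifold which
becomes round at the rates `|hR − 2| ≤ Ch^δ`, `h²(|Ric|² − R²/4) ≤ Ch^{2δ}`,
`h²(|Rm|² − 2|Ric|² + R²/3) ≤ Ch^δ` on `[t₀, T)` (`h = T − t`) and satisfies the scaled Shi bounds
`|∇ᵏRm|² ≤ C'h^{−k−2}` near `T`, the first derivative of the curvature DECAYS one order better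
than scaling: `|∇Rm|² ≤ C₁ h^{δ₁−3}` on `M × [t₁, T)` for some `δ₁ > 0` — GIVEN, as hypotheses
supplied by the neighbouring helpers of the skeleton, the evolution inequality of the round
defect `P = |Rm|² − 2R/(3h) + 2/(3h²)`,
`∂ₜP ≤ ΔP − 2|∇Rm|² + C₂(|Rm|² + h⁻²)√|P| + C₂√|Rm|² |P|` (`helper_roundDefect_evolution`), and
the Bernstein window lemma (`helper_bernsteinWindow`; Topping 2006, proof of Thm. 3.3.1).

Proof (`helper_curvDeriv_decay_one`). The window lemma is fed with `θ = 2`, `f = P` — smooth on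
`M × [0, T)` (`contMDiffOn_roundDefect`: `|Rm|² = U_0`, `IsRicciFlow.contMDiffOn_curvDerivNormSq`,
`curvDerivNormSq_zero_eq`; `R`, `IsContMDiffFamilyOn.contMDiffOn_scalarCurvatureWith`) and
nonnegative (`P = |W|² + 2|E|² + (hR − 2)²/(6h²)`, `roundDefect_nonneg` with
`traceless_weyl_nonneg`, Besse 1987, (1.116)–1.118) —, `F = |∇Rm|² = U_1`
(`IsRicciFlow.contMDiffOn_curvDerivNormSq`, `curvDerivNormSq_nonneg`), `Φf` the reaction term
of the hypothesis, and `ΦF` the reaction term of the tree's evolution inequality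
`IsRicciFlow.derivWithin_curvDerivNormSq_le` (Topping 2006, (3.3.4), `k = 1`, one constant on the
closed manifold), which is `≤ 3C√|Rm|² |∇Rm|²` (`curvDeriv_one_reaction_le`). The real-variable
bookkeeping — `P ≤ C_P h^{2δ₁−2}`, `Φf ≤ C_a h^{δ₁−3}`, `|Rm|² ≤ C_Q h⁻²` (the Shi bound of order
`0`), the choice of the windows `[t₁, t₁ + κ(T − t₁)]` and the output `δ₁ = min δ 1 / 2` — is
`helper_curvDeriv_decayWindow` of the Aux file.

## References

* R. S. Hamilton, *Three-manifolds with positive Ricci curvature*, J. Differential Geom. 17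
  (1982) 255–306, §17, Thm. 17.6 (with §13, Thm. 13.4 ff.). [Hamilton1982]
* P. Topping, *Lectures on the Ricci flow*, LMS Lecture Note Series 325, CUP 2006, §3.3,
  Thm. 3.3.1 and its proof, (3.3.4). [Topping2006]
* A. L. Besse, *Einstein manifolds*, Springer 1987, (1.116)–1.118. [Besse1987]
-/

noncomputable section

-- every `Summit.SmoothPoincare4.SmoothPoincare4.…` name repeats the summit = sub-problem segment (D-0017 layout)
set_option linter.dupNamespace false

open Set Function Filter
open scoped Manifold ContDiff Topology

namespace Summit.SmoothPoincare4.SmoothPoincare4.Theorems.MargerinRails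

open Literature.Geometry.Riemannian
open Literature.Geometry.Lorentzian Literature.Geometry.Lorentzian.PseudoRiemannianMetric

/-! ### The pieces on the manifold -/

section FourDim

variable {M : Type*} [TopologicalSpace M] [ChartedSpace (EuclideanSpace ℝ (Fin 4)) M]
  [IsManifold (𝓡 4) ∞ M]
  {g : ℝ → PseudoRiemannianMetric (𝓡 4) ∞ (EuclideanSpace ℝ (Fin 4)) (TangentSpace (𝓡 4) : M → Type _)}
  {cov : ℝ → CovariantDerivative (𝓡 4) (EuclideanSpace ℝ (Fin 4)) (TangentSpace (𝓡 4) : M → Type _)}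
  {T : ℝ}

/-- **`|E|² ≥ 0` and `|W|² ≥ 0` along the flow, in the `cov t` quantities** (Besse 1987,
(1.116)–1.118; tree `tracelessRicciNormSq_eq_normSq`, `weylNormSq_eq_curvNormSqWith`, as in
`roundness_dictionary`): `0 ≤ |Ric|² − R²/4` and `0 ≤ |Rm|² − 2|Ric|² + R²/3` for a Riemannian
member of a Ricci flow on a 4-manifold. [cite: Hamilton1982, §17, Thm. 17.6]
[cite: Besse1987, (1.116)–1.118] -/
theorem traceless_weyl_nonneg (hflow : IsRicciFlow g cov (Ico 0 T))
    (hRiem : ∀ t ∈ Ico 0 T, (g t).IsRiemannian) {t : ℝ} (ht : t ∈ Ico 0 T) (x : M) :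
    0 ≤ (g t).normSq x ((cov t).ricci x) - (g t).scalarCurvatureWith (cov t) x ^ 2 / 4 ∧
    0 ≤ (g t).curvNormSqWith (cov t) x - 2 * (g t).normSq x ((cov t).ricci x) +
        (g t).scalarCurvatureWith (cov t) x ^ 2 / 3 := by
  haveI := (g t).hasLeviCivita
  have h2 : (2 : ℕ∞ω) ≤ ∞ := WithTop.coe_le_coe.mpr le_top
  have hLC := hflow.isLeviCivita t ht
  have hric : (cov t).ricci x = (g t).ricci x := hLC.ricci_eq_ricci h2 x
  have hscal : (g t).scalarCurvatureWith (cov t) x = (g t).scalarCurvature x := by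
    show (g t).trace x ((cov t).ricci x) = (g t).trace x ((g t).ricci x)
    rw [hric]
  have hcurv : (g t).curvNormSqWith (cov t) x = (g t).curvNormSqWith (g t).leviCivita x :=
    (g t).curvNormSqWith_congr (hLC.curvature_eq_riemann h2 x)
  have hE := (g t).tracelessRicciNormSq_eq_normSq (hRiem t ht) finrank_euclideanSpace_fin x
  have hW := (g t).weylNormSq_eq_curvNormSqWith (hRiem t ht) finrank_euclideanSpace_fin x
  have hEnn := (g t).tracelessRicciNormSq_nonneg x
  have hWnn := (g t).weylNormSq_nonneg x
  rw [hric, hscal, hcurv]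
  exact ⟨by rw [← hE]; exact hEnn, by rw [← hW]; exact hWnn⟩

/-- **The round defect `P = |Rm|² − 2R/(3(T−t)) + 2/(3(T−t)²)` is smooth on `M × [0, T)`** along a
Ricci flow of Riemannian metrics (`|Rm|² = U_0`, `IsRicciFlow.contMDiffOn_curvDerivNormSq`; `R`,
`IsContMDiffFamilyOn.contMDiffOn_scalarCurvatureWith`; Topping 2006, §1.2.3).
[cite: Topping2006, Thm. 3.3.1] [cite: Hamilton1982, §17, Thm. 17.6] -/
theorem contMDiffOn_roundDefect (hflow : IsRicciFlow g cov (Ico 0 T)) (hT : 0 < T)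
    (hRiem : ∀ t ∈ Ico 0 T, (g t).IsRiemannian) :
    ContMDiffOn ((𝓡 4).prod 𝓘(ℝ, ℝ)) 𝓘(ℝ, ℝ) ∞
      (fun p : M × ℝ ↦ (g p.2).curvNormSqWith (cov p.2) p.1 -
        2 * (g p.2).scalarCurvatureWith (cov p.2) p.1 / (3 * (T - p.2)) + 2 / (3 * (T - p.2) ^ 2))
      (univ ×ˢ Ico 0 T) := by
  have hS : UniqueDiffOn ℝ (Ico 0 T) := uniqueDiffOn_Ico 0 T
  have hS' : Ico 0 T ⊆ closure (interior (Ico 0 T)) := Ico_subset_closure_interior hT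
  have hQs : ContMDiffOn ((𝓡 4).prod 𝓘(ℝ, ℝ)) 𝓘(ℝ, ℝ) ∞
      (fun p : M × ℝ ↦ (g p.2).curvNormSqWith (cov p.2) p.1) (univ ×ˢ Ico 0 T) :=
    (hflow.contMDiffOn_curvDerivNormSq hS hS' hRiem 0).congr fun p hp ↦
      (curvDerivNormSq_zero_eq (hRiem p.2 hp.2) (hflow.isLeviCivita p.2 hp.2) p.1).symm
  have hRs : ContMDiffOn ((𝓡 4).prod 𝓘(ℝ, ℝ)) 𝓘(ℝ, ℝ) ∞
      (fun p : M × ℝ ↦ (g p.2).scalarCurvatureWith (cov p.2) p.1) (univ ×ˢ Ico 0 T) :=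
    hflow.smooth.contMDiffOn_scalarCurvatureWith hflow.isLeviCivita
  have hts : ContMDiffOn ((𝓡 4).prod 𝓘(ℝ, ℝ)) 𝓘(ℝ, ℝ) ∞ (fun p : M × ℝ ↦ T - p.2)
      (univ ×ˢ Ico 0 T) := (contMDiff_const.sub contMDiff_snd).contMDiffOn
  have hne : ∀ p : M × ℝ, p ∈ univ ×ˢ Ico (0 : ℝ) T → (3 * (T - p.2) : ℝ) ≠ 0 := fun p hp ↦
    mul_ne_zero three_ne_zero (sub_pos.2 hp.2.2).ne'
  have hne2 : ∀ p : M × ℝ, p ∈ univ ×ˢ Ico (0 : ℝ) T → (3 * (T - p.2) ^ 2 : ℝ) ≠ 0 := fun p hp ↦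
    mul_ne_zero three_ne_zero (pow_ne_zero 2 (sub_pos.2 hp.2.2).ne')
  have hi1 : ContMDiffOn ((𝓡 4).prod 𝓘(ℝ, ℝ)) 𝓘(ℝ, ℝ) ∞ (fun p : M × ℝ ↦ (3 * (T - p.2))⁻¹)
      (univ ×ˢ Ico 0 T) := (contMDiffOn_const.mul hts).inv₀ hne
  have hi2 : ContMDiffOn ((𝓡 4).prod 𝓘(ℝ, ℝ)) 𝓘(ℝ, ℝ) ∞ (fun p : M × ℝ ↦ (3 * (T - p.2) ^ 2)⁻¹)
      (univ ×ˢ Ico 0 T) := (contMDiffOn_const.mul (hts.pow 2)).inv₀ hne2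
  have h := (hQs.sub ((contMDiffOn_const (c := (2 : ℝ))).mul hRs |>.mul hi1)).add
    ((contMDiffOn_const (c := (2 : ℝ))).mul hi2)
  refine h.congr fun p _ ↦ ?_
  simp only [Pi.add_apply, Pi.mul_apply, div_eq_mul_inv, mul_assoc]

/-- **The reaction term of the evolution inequality of `|∇Rm|²`** (Topping 2006, (3.3.4), `k = 1`):
`−2|∇²Rm|² + C(Σ_{p<2} √U_p √U_{1−p})√U_1 + C√U_0 U_1 ≤ 3C √|Rm|² |∇Rm|²`.
[cite: Topping2006, Thm. 3.3.1] [cite: Hamilton1982, §17, Thm. 17.6] -/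
theorem curvDeriv_one_reaction_le (hflow : IsRicciFlow g cov (Ico 0 T))
    (hRiem : ∀ t ∈ Ico 0 T, (g t).IsRiemannian) {Cs : ℝ} {t : ℝ} (ht : t ∈ Ico 0 T) (x : M) :
    -2 * curvDerivNormSq (𝓡 4) g (1 + 1) t x +
      Cs * (∑ p ∈ Finset.range (1 + 1), Real.sqrt (curvDerivNormSq (𝓡 4) g p t x) *
        Real.sqrt (curvDerivNormSq (𝓡 4) g (1 - p) t x)) * Real.sqrt (curvDerivNormSq (𝓡 4) g 1 t x) +
      Cs * Real.sqrt (curvDerivNormSq (𝓡 4) g 0 t x) * curvDerivNormSq (𝓡 4) g 1 t x ≤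
    3 * Cs * Real.sqrt ((g t).curvNormSqWith (cov t) x) * curvDerivNormSq (𝓡 4) g 1 t x := by
  have hF2 : 0 ≤ curvDerivNormSq (𝓡 4) g (1 + 1) t x := curvDerivNormSq_nonneg (hRiem t ht) _ x
  have hF1 : 0 ≤ curvDerivNormSq (𝓡 4) g 1 t x := curvDerivNormSq_nonneg (hRiem t ht) 1 x
  have hsum : ∑ p ∈ Finset.range (1 + 1), Real.sqrt (curvDerivNormSq (𝓡 4) g p t x) *
      Real.sqrt (curvDerivNormSq (𝓡 4) g (1 - p) t x) =
      2 * (Real.sqrt (curvDerivNormSq (𝓡 4) g 0 t x) * Real.sqrt (curvDerivNormSq (𝓡 4) g 1 t x)) := by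
    simp only [Finset.sum_range_succ, Finset.sum_range_zero, Nat.sub_zero, Nat.sub_self, zero_add]
    ring
  have hsq : Real.sqrt (curvDerivNormSq (𝓡 4) g 1 t x) * Real.sqrt (curvDerivNormSq (𝓡 4) g 1 t x) =
      curvDerivNormSq (𝓡 4) g 1 t x := Real.mul_self_sqrt hF1
  rw [hsum, curvDerivNormSq_zero_eq (hRiem t ht) (hflow.isLeviCivita t ht) x]
  have key : Cs * (2 * (Real.sqrt ((g t).curvNormSqWith (cov t) x) *
      Real.sqrt (curvDerivNormSq (𝓡 4) g 1 t x))) * Real.sqrt (curvDerivNormSq (𝓡 4) g 1 t x) +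
      Cs * Real.sqrt ((g t).curvNormSqWith (cov t) x) * curvDerivNormSq (𝓡 4) g 1 t x =
      3 * Cs * Real.sqrt ((g t).curvNormSqWith (cov t) x) * curvDerivNormSq (𝓡 4) g 1 t x := by
    linear_combination (2 * Cs * Real.sqrt ((g t).curvNormSqWith (cov t) x)) * hsq
  linarith [key, hF2]

end FourDim

/-- **HELPER S3b — DECAY OF `|∇Rm|²` FOR A ROUNDENING TYPE-I FLOW (Hamilton 1982, §17, Thm. 17.6,
`k = 1`, maximum-principle form; Topping 2006, Thm. 3.3.1).** Along a Ricci flow of Riemannian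
metrics on `[0, T)`, `T > 0`, on a closed 4-manifold with the roundness rates
`|hR − 2| ≤ Ch^δ`, `h²|E|² ≤ Ch^{2δ}`, `h²|W|² ≤ Ch^δ` on `[t₀, T)` (`h = T − t`), the scaled Shi
bounds `|∇ᵏRm|² ≤ C'h^{−k−2}` near `T`, the evolution inequality of the round defect
`P = |Rm|² − 2R/(3h) + 2/(3h²)` (hypothesis, neighbour `helper_roundDefect_evolution`) and the
Bernstein window lemma (hypothesis, neighbour `helper_bernsteinWindow`), there are `δ₁ > 0`, `C₁`
and `t₁ ∈ [0, T)` with `|∇Rm|² ≤ C₁ h^{δ₁−3}` on `M × [t₁, T)`. Proof: the window lemma is fed with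
`θ = 2`, `f = P` (smooth on `M × [0, T)`, `contMDiffOn_roundDefect`; nonnegative,
`roundDefect_nonneg` with `traceless_weyl_nonneg`), `F = |∇Rm|²`
(`IsRicciFlow.contMDiffOn_curvDerivNormSq`, `curvDerivNormSq_nonneg`), `Φf` the reaction term of
the hypothesis and `ΦF` that of `IsRicciFlow.derivWithin_curvDerivNormSq_le` (`k = 1`, bounded by
`3C√|Rm|² |∇Rm|²`, `curvDeriv_one_reaction_le`); the bookkeeping is
`helper_curvDeriv_decayWindow` of the Aux file (`δ₁ = min δ 1 / 2`). [cite: Hamilton1982, §17, Thm. 17.6]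
[cite: Topping2006, Thm. 3.3.1] -/
theorem helper_curvDeriv_decay_one : ∀ (M : Type) [TopologicalSpace M] [T2Space M] [SecondCountableTopology M] [ChartedSpace (EuclideanSpace ℝ (Fin 4)) M] [IsManifold (𝓡 4) ∞ M] [CompactSpace M] (g : ℝ → PseudoRiemannianMetric (𝓡 4) ∞ (EuclideanSpace ℝ (Fin 4)) (TangentSpace (𝓡 4) : M → Type _)) (cov : ℝ → CovariantDerivative (𝓡 4) (EuclideanSpace ℝ (Fin 4)) (TangentSpace (𝓡 4) : M → Type _)) (T : ℝ), 0 < T → IsRicciFlow g cov (Ico 0 T) → (∀ t ∈ Ico 0 T, (g t).IsRiemannian) → ∀ (δ C t₀ : ℝ), 0 < δ → t₀ ∈ Ico 0 T → (∀ t ∈ Ico t₀ T, ∀ x : M, |(T - t) * (g t).scalarCurvatureWith (cov t) x - 2| ≤ C * (T - t) ^ δ ∧ (T - t) ^ 2 * ((g t).normSq x ((cov t).ricci x) - (g t).scalarCurvatureWith (cov t) x ^ 2 / 4) ≤ C * (T - t) ^ (2 * δ) ∧ (T - t) ^ 2 * ((g t).curvNormSqWith (cov t) x - 2 * (g t).normSq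 x ((cov t).ricci x) + (g t).scalarCurvatureWith (cov t) x ^ 2 / 3) ≤ C * (T - t) ^ δ) → (∀ k : ℕ, ∃ C' t₁ : ℝ, t₁ ∈ Ico 0 T ∧ ∀ t ∈ Ico t₁ T, ∀ z : M, curvDerivNormSq (𝓡 4) g k t z ≤ C' * ((T - t) ^ (k + 2))⁻¹) → (∃ C₂ : ℝ, 0 ≤ C₂ ∧ ∀ t ∈ Ico 0 T, ∀ x : M, derivWithin (fun s ↦ ((g s).curvNormSqWith (cov s) x - 2 * (g s).scalarCurvatureWith (cov s) x / (3 * (T - s)) + 2 / (3 * (T - s) ^ 2))) (Ico 0 T) t ≤ (g t).laplaceBeltrami (fun y ↦ (g t).curvNormSqWith (cov t) y - 2 * (g t).scalarCurvatureWith (cov t) y / (3 * (T - t)) + 2 / (3 * (T - t) ^ 2)) x - 2 * curvDerivNormSq (𝓡 4) g 1 t x + C₂ * ((g t).curvNormSqWith (cov t) x + ((T - t) ^ 2)⁻¹) * Real.sqrt |((g t).curvNormSqWith (cov t) x - 2 * (g t).scalarCurvatureWith (cov t) x / (3 * (T - t)) + 2 / (3 * (T - t) ^ 2))| + C₂ *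 Real.sqrt ((g t).curvNormSqWith (cov t) x) * |((g t).curvNormSqWith (cov t) x - 2 * (g t).scalarCurvatureWith (cov t) x / (3 * (T - t)) + 2 / (3 * (T - t) ^ 2))|) → (∀ (θ : ℝ) (f F Φf ΦF : ℝ → M → ℝ), 0 < θ → ContMDiffOn ((𝓡 4).prod 𝓘(ℝ, ℝ)) 𝓘(ℝ, ℝ) ∞ (fun p : M × ℝ ↦ f p.2 p.1) (univ ×ˢ Ico 0 T) → ContMDiffOn ((𝓡 4).prod 𝓘(ℝ, ℝ)) 𝓘(ℝ, ℝ) ∞ (fun p : M × ℝ ↦ F p.2 p.1) (univ ×ˢ Ico 0 T) → (∀ t ∈ Ico 0 T, ∀ x : M, 0 ≤ f t x) → (∀ t ∈ Ico 0 T, ∀ x : M, 0 ≤ F t x) → (∀ t ∈ Ico 0 T, ∀ x : M, derivWithin (fun s ↦ f s x) (Ico 0 T) t ≤ (g t).laplaceBeltrami (f t) x - θ * F t x + Φf t x) → (∀ t ∈ Ico 0 T, ∀ x : M, derivWithin (fun s ↦ F s x) (Ico 0 T) t ≤ (g t).laplaceBeltrami (F t) x + ΦF t x) → ∀ (t₁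 τ K a b A₀ : ℝ), t₁ ∈ Ico 0 T → 0 < τ → t₁ + τ < T → 0 ≤ K → 0 ≤ a → 0 ≤ b → K * τ ≤ 1 → (∀ x : M, f t₁ x ≤ A₀) → (∀ t ∈ Icc t₁ (t₁ + τ), ∀ x : M, Φf t x ≤ a) → (∀ t ∈ Icc t₁ (t₁ + τ), ∀ x : M, ΦF t x ≤ K * F t x + b) → ∀ t ∈ Icc t₁ (t₁ + τ), ∀ x : M, (t - t₁) * F t x ≤ 2 / θ * A₀ + τ * (τ * b + 2 * a / θ)) → ∃ δ₁ C₁ t₁ : ℝ, 0 < δ₁ ∧ t₁ ∈ Ico 0 T ∧ ∀ t ∈ Ico t₁ T, ∀ x : M, curvDerivNormSq (𝓡 4) g 1 t x ≤ C₁ * (T - t) ^ (δ₁ - 3) := by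
  intro M _ _ _ _ _ _ g cov T hT hflow hR δ C t₀ hδ ht₀ hrate hshi hP hW
  -- the evolution inequality of `|∇Rm|²` with ONE constant (Topping (3.3.4), `k = 1`)
  have hS : UniqueDiffOn ℝ (Ico 0 T) := uniqueDiffOn_Ico 0 T
  have hS' : Ico 0 T ⊆ closure (interior (Ico 0 T)) := Ico_subset_closure_interior hT
  have h0T : (0 : ℝ) ∈ Ico 0 T := ⟨le_rfl, hT⟩
  obtain ⟨Cs, hCs0, hShi⟩ := hflow.derivWithin_curvDerivNormSq_le hS hS' hR h0T 1
  obtain ⟨C₂, hC₂0, hPev⟩ := hP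
  -- the curvature scale `|Rm|² = U_0 ≤ C_Q h⁻²`
  obtain ⟨CQ, tQ, htQ, hQ⟩ := hshi 0
  have hQ' : ∀ t ∈ Ico tQ T, ∀ x : M,
      (g t).curvNormSqWith (cov t) x ≤ CQ * ((T - t) ^ 2)⁻¹ := by
    intro t ht x
    have htT : t ∈ Ico 0 T := ⟨htQ.1.trans ht.1, ht.2⟩
    have h := hQ t ht x
    rwa [curvDerivNormSq_zero_eq (hR t htT) (hflow.isLeviCivita t htT), zero_add] at h
  -- nonnegativity of the round defect and of `|∇Rm|²`
  have hP0 : ∀ t ∈ Ico 0 T, ∀ x : M, 0 ≤ (g t).curvNormSqWith (cov t) x -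
      2 * (g t).scalarCurvatureWith (cov t) x / (3 * (T - t)) + 2 / (3 * (T - t) ^ 2) := by
    intro t ht x
    obtain ⟨hE, hWy⟩ := traceless_weyl_nonneg hflow hR ht x
    exact roundDefect_nonneg (sub_pos.2 ht.2) hE hWy
  have hF0 : ∀ t ∈ Ico 0 T, ∀ x : M, 0 ≤ curvDerivNormSq (𝓡 4) g 1 t x := fun t ht x ↦
    curvDerivNormSq_nonneg (hR t ht) 1 x
  -- the two evolution inequalities in the shape of the window lemma
  have hfev : ∀ t ∈ Ico 0 T, ∀ x : M,
      derivWithin (fun s ↦ ((g s).curvNormSqWith (cov s) x -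
        2 * (g s).scalarCurvatureWith (cov s) x / (3 * (T - s)) + 2 / (3 * (T - s) ^ 2))) (Ico 0 T) t ≤
      (g t).laplaceBeltrami (fun y ↦ (g t).curvNormSqWith (cov t) y -
        2 * (g t).scalarCurvatureWith (cov t) y / (3 * (T - t)) + 2 / (3 * (T - t) ^ 2)) x -
        2 * curvDerivNormSq (𝓡 4) g 1 t x +
      (C₂ * ((g t).curvNormSqWith (cov t) x + ((T - t) ^ 2)⁻¹) *
          Real.sqrt |((g t).curvNormSqWith (cov t) x -
            2 * (g t).scalarCurvatureWith (cov t) x / (3 * (T - t)) + 2 / (3 * (T - t) ^ 2))| +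
        C₂ * Real.sqrt ((g t).curvNormSqWith (cov t) x) *
          |((g t).curvNormSqWith (cov t) x -
            2 * (g t).scalarCurvatureWith (cov t) x / (3 * (T - t)) + 2 / (3 * (T - t) ^ 2))|) :=
    fun t ht x ↦ (hPev t ht x).trans_eq (add_assoc _ _ _)
  have hFev : ∀ t ∈ Ico 0 T, ∀ x : M,
      derivWithin (fun s ↦ curvDerivNormSq (𝓡 4) g 1 s x) (Ico 0 T) t ≤
      (g t).laplaceBeltrami (curvDerivNormSq (𝓡 4) g 1 t) x +
        (-2 * curvDerivNormSq (𝓡 4) g (1 + 1) t x +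
          Cs * (∑ p ∈ Finset.range (1 + 1), Real.sqrt (curvDerivNormSq (𝓡 4) g p t x) *
            Real.sqrt (curvDerivNormSq (𝓡 4) g (1 - p) t x)) *
            Real.sqrt (curvDerivNormSq (𝓡 4) g 1 t x) +
          Cs * Real.sqrt (curvDerivNormSq (𝓡 4) g 0 t x) * curvDerivNormSq (𝓡 4) g 1 t x) :=
    fun t ht x ↦ (hShi t ht x).trans_eq (by ring)
  -- the window lemma for the pair `(P, |∇Rm|²)` with `θ = 2`
  have hwin := hW 2
    (fun t x ↦ (g t).curvNormSqWith (cov t) x -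
      2 * (g t).scalarCurvatureWith (cov t) x / (3 * (T - t)) + 2 / (3 * (T - t) ^ 2))
    (curvDerivNormSq (𝓡 4) g 1)
    (fun t x ↦ C₂ * ((g t).curvNormSqWith (cov t) x + ((T - t) ^ 2)⁻¹) *
          Real.sqrt |((g t).curvNormSqWith (cov t) x -
            2 * (g t).scalarCurvatureWith (cov t) x / (3 * (T - t)) + 2 / (3 * (T - t) ^ 2))| +
        C₂ * Real.sqrt ((g t).curvNormSqWith (cov t) x) *
          |((g t).curvNormSqWith (cov t) x -
            2 * (g t).scalarCurvatureWith (cov t) x / (3 * (T - t)) + 2 / (3 * (T - t) ^ 2))|)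
    (fun t x ↦ -2 * curvDerivNormSq (𝓡 4) g (1 + 1) t x +
          Cs * (∑ p ∈ Finset.range (1 + 1), Real.sqrt (curvDerivNormSq (𝓡 4) g p t x) *
            Real.sqrt (curvDerivNormSq (𝓡 4) g (1 - p) t x)) *
            Real.sqrt (curvDerivNormSq (𝓡 4) g 1 t x) +
          Cs * Real.sqrt (curvDerivNormSq (𝓡 4) g 0 t x) * curvDerivNormSq (𝓡 4) g 1 t x)
    two_pos (contMDiffOn_roundDefect hflow hT hR) (hflow.contMDiffOn_curvDerivNormSq hS hS' hR 1)
    hP0 hF0 hfev hFev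
  -- the bookkeeping
  exact helper_curvDeriv_decayWindow M T δ C t₀ tQ CQ C₂ Cs _ _ _
    (fun t x ↦ (g t).curvNormSqWith (cov t) x -
      2 * (g t).scalarCurvatureWith (cov t) x / (3 * (T - t)) + 2 / (3 * (T - t) ^ 2)) _ _ _
    hδ ht₀ htQ hC₂0 hCs0 hrate hQ' (fun t x ↦ rfl) hP0 hF0 (fun t ht x ↦ le_rfl)
    (fun t ht x ↦ curvDeriv_one_reaction_le hflow hR ht x) hwin

end Summit.SmoothPoincare4.SmoothPoincare4.Theorems.MargerinRails

end
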